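import Summits.CriticalPhenomena.PercolationContinuityZ3.Theorems.PercNearOneGluingNoHeavyLowerTailSunflowerOpenProductSupport
import Summits.CriticalPhenomena.PercolationContinuityZ3.Theorems.PercNearOneGluingNoHeavyLowerTailSunflowerGrainCertificate

/-!
# `NoHeavyLowerTail` (crux stmt-CriticalPhenomena-4575), abstract sunflower cubic: THE ATOMIC (MAXITIVE) CERTIFICATE INEQUALITY
# (memo FINDING-PAR-prove1-g46 THEOREM 4 = g45 (MC-atomic)): `1 - ∑_i m_i ρ_i ≤ ∏_{S ∈ ℛ} t_S[m·β]`

Support file (seat `prim-ineq-prove-1` gen 46; `--supports stmt-CriticalPhenomena-4575`).  No `sorry`.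
For masses `m ≥ 0` with `∑ m < 1`, marks `β ∈ [0,1]^ι`, `φ_i = m_i β_i`, a family `ℛ` and any `ρ ≥ 0` with
`∏_{j ∈ S} β_j ≤ ρ_i` for all `S ∈ ℛ`, `i ∈ S` (e.g. `ρ_i = max_{S ∋ i} β_S`):   **`one_sub_le_FR_atomic`**: `1 - ∑_i m_i ρ_i ≤ FR φ ℛ`.
By g45 §4c this gives the Möbius-certificate inequality (MC) for EVERY finite lattice, every law of `X` and every supermultiplicative `Y`
(in particular the cube with `X` arbitrary and `Y` product).  PROOF: `1 - FR φ ℛ = ∑_γ c_γ φ^γ` with `c_γ ≥ 0` ((PAR)) and `supp γ ∈ ℛ`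
(`OpenProduct.support_mem_of_coeff_ne_zero`), so `c_γ φ^γ ≤ c_γ m^γ · min_{i ∈ supp γ} ρ_i`; then a peeling induction on the letters
(subtract the smallest `ρ`; the level term is `∑_{supp γ ⊆ J} c_γ m^γ ≤ m(J)` = `Grain.one_sub_le_FR`).
-/

noncomputable section

namespace Summit.CriticalPhenomena.PercolationContinuityZ3.Theorems.SunflowerPartition

namespace Grain

open Finset MvPowerSeries OpenProduct SeriesEval

variable {ι : Type*} [Fintype ι] [DecidableEq ι]

/-- The minimum of `ρ` over a finite set (`0` on the empty set). [this work] -/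
def fmin (ρ : ι → ℝ) (T : Finset ι) : ℝ := if h : T.Nonempty then T.inf' h ρ else 0

omit [Fintype ι] [DecidableEq ι] in
/-- `fmin ρ T ≤ ρ i` for `i ∈ T`. [this work] -/
theorem fmin_le (ρ : ι → ℝ) {T : Finset ι} {i : ι} (hi : i ∈ T) : fmin ρ T ≤ ρ i := by
  rw [fmin, dif_pos ⟨i, hi⟩]; exact inf'_le ρ hi

omit [Fintype ι] [DecidableEq ι] in
/-- `fmin ρ T ≥ 0` for `ρ ≥ 0` on `T`. [this work] -/
theorem fmin_nonneg (ρ : ι → ℝ) (T : Finset ι) (hρ : ∀ i ∈ T, 0 ≤ ρ i) : 0 ≤ fmin ρ T := by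
  unfold fmin; split_ifs with h
  · exact (le_inf'_iff h ρ).mpr hρ
  · exact le_rfl

omit [Fintype ι] [DecidableEq ι] in
/-- Shifting `ρ` by a constant shifts `fmin` (nonempty `T`). [this work] -/
theorem fmin_sub_const (ρ : ι → ℝ) (t : ℝ) {T : Finset ι} (hT : T.Nonempty) :
    fmin (fun i => ρ i - t) T = fmin ρ T - t := by
  rw [fmin, dif_pos hT, fmin, dif_pos hT]
  refine le_antisymm ?_ ?_
  · obtain ⟨i, hi, hmin⟩ := exists_mem_eq_inf' hT ρ
    rw [hmin]; exact inf'_le _ hi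
  · refine (le_inf'_iff hT _).mpr fun i hi => ?_
    linarith [inf'_le ρ hi]

omit [Fintype ι] [DecidableEq ι] in
/-- `fmin ρ T = 0` if `ρ ≥ 0` on `T` vanishes somewhere on `T`. [this work] -/
theorem fmin_eq_zero (ρ : ι → ℝ) {T : Finset ι} (hρ : ∀ i ∈ T, 0 ≤ ρ i) {i : ι} (hi : i ∈ T) (h0 : ρ i = 0) :
    fmin ρ T = 0 :=
  le_antisymm (h0 ▸ fmin_le ρ hi) (fmin_nonneg ρ T hρ)

/-! ## The weighted coefficient sums `E J ρ = ∑_{supp γ ⊆ J} c_γ m^γ · min_{supp γ} ρ` -/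

variable (ℛ : Finset (Finset ι)) (m : ι → ℝ)

/-- The nonnegative series `P = 1 - ∏_{S∈ℛ} tS S`. [this work] -/
def Pser : MvPowerSeries ι ℚ := 1 - ∏ S ∈ ℛ, tS S

/-- The coefficient `c_γ` of `P`, as a real number. [this work] -/
def cf (γ : ι →₀ ℕ) : ℝ := ((coeff γ (Pser ℛ) : ℚ) : ℝ)

/-- `E J ρ = ∑' γ, [supp γ ⊆ J] c_γ m^γ fmin ρ (supp γ)`. [this work] -/
def E (J : Finset ι) (ρ : ι → ℝ) : ℝ :=
  ∑' γ : ι →₀ ℕ, if γ.support ⊆ J then cf ℛ γ * mono m γ * fmin ρ γ.support else 0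

variable {ℛ m}

/-- `c_γ ≥ 0` for union-closed `ℛ` ((PAR)). [this work] -/
theorem cf_nonneg (hℛ : ∀ S ∈ ℛ, ∀ S' ∈ ℛ, S ∪ S' ∈ ℛ) (γ : ι →₀ ℕ) : 0 ≤ cf ℛ γ := by
  unfold cf Pser; exact_mod_cast coeff_one_sub_prod_tS_nonneg ℛ hℛ γ

/-- The basic summable family `γ ↦ c_γ m^γ` (`m ≥ 0`, `∑ m < 1`). [this work] -/
theorem summable_cf_mono (hm : ∀ i, 0 ≤ m i) (hm1 : ∑ i, m i < 1) :
    Summable fun γ : ι →₀ ℕ => cf ℛ γ * mono m γ := by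
  have hA : AbsConv m (Pser ℛ) := absConv_one.sub hm (ev_prod_tS hm hm1 ℛ).1
  have h := hA.summable hm
  exact h

/-- `∑' γ, c_γ (m·1_J)^γ = 1 - FR (m·1_J) ℛ ≤ m(J)`: the level inequality. [this work] -/
theorem tsum_cf_mono_indicator_le (hm : ∀ i, 0 ≤ m i) (hm1 : ∑ i, m i < 1) (J : Finset ι) :
    ∑' γ : ι →₀ ℕ, (if γ.support ⊆ J then cf ℛ γ * mono m γ else 0) ≤ ∑ i ∈ J, m i := by
  set x : ι → ℝ := fun i => if i ∈ J then m i else 0 with hx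
  have hx0 : ∀ i, 0 ≤ x i := fun i => by simp only [hx]; split_ifs <;> simp [hm i]
  have hx1 : ∑ i, x i < 1 := lt_of_le_of_lt (sum_le_sum fun i _ => by
    simp only [hx]; split_ifs <;> simp [hm i]) hm1
  have hmono : ∀ γ : ι →₀ ℕ, mono x γ = if γ.support ⊆ J then mono m γ else 0 := by
    intro γ
    unfold mono
    split_ifs with h
    · refine prod_congr rfl fun i _ => ?_
      by_cases hi : i ∈ J
      · simp [hx, hi]
      · have : γ i = 0 := by
          by_contra hne
          exact hi (h (Finsupp.mem_support_iff.mpr hne))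
        rw [this, pow_zero, pow_zero]
    · obtain ⟨i, hi, hiJ⟩ := not_subset.mp h
      refine prod_eq_zero (mem_univ i) ?_
      rw [hx]; simp only [hiJ, if_false]
      exact zero_pow (Finsupp.mem_support_iff.mp hi)
  have hF := ev_prod_tS hx0 hx1 ℛ
  have hev : ev x (Pser ℛ) = 1 - FR x ℛ := by
    rw [Pser, ev_sub hx0 absConv_one hF.1, ev_one, hF.2]
  have hsum : ∑' γ : ι →₀ ℕ, (if γ.support ⊆ J then cf ℛ γ * mono m γ else 0) = ev x (Pser ℛ) := by
    unfold ev
    refine tsum_congr fun γ => ?_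
    rw [term, hmono γ, cf]
    split_ifs <;> simp
  rw [hsum, hev]
  have h1 := one_sub_le_FR hx0 hx1 ℛ univ fun S _ => subset_univ S
  have h2 : ∑ a ∈ (univ : Finset ι), x a = ∑ i ∈ J, m i := by
    rw [hx]; simp only [sum_ite_mem, univ_inter]
  linarith

/-- Summability of the families entering `E`. [this work] -/
theorem summable_E_family (hℛ : ∀ S ∈ ℛ, ∀ S' ∈ ℛ, S ∪ S' ∈ ℛ) (hm : ∀ i, 0 ≤ m i) (hm1 : ∑ i, m i < 1)
    (J : Finset ι) (ρ : ι → ℝ) (M : ℝ) (hM0 : 0 ≤ M) (hM : ∀ i, |ρ i| ≤ M) :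
    Summable fun γ : ι →₀ ℕ => if γ.support ⊆ J then cf ℛ γ * mono m γ * fmin ρ γ.support else 0 := by
  have hbase := summable_cf_mono (ℛ := ℛ) hm hm1
  refine Summable.of_norm_bounded (g := fun γ => M * (cf ℛ γ * mono m γ)) (hbase.mul_left M) fun γ => ?_
  have hc : 0 ≤ cf ℛ γ * mono m γ := mul_nonneg (cf_nonneg hℛ γ) (mono_nonneg hm γ)
  have hfmin : |fmin ρ γ.support| ≤ M := by
    unfold fmin; split_ifs with h
    · obtain ⟨i, hi, heq⟩ := exists_mem_eq_inf' h ρ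
      rw [heq]; exact hM i
    · rw [abs_zero]; exact hM0
  split_ifs
  · rw [Real.norm_eq_abs, abs_mul, abs_of_nonneg hc]
    calc cf ℛ γ * mono m γ * |fmin ρ γ.support| ≤ cf ℛ γ * mono m γ * M := by gcongr
      _ = M * (cf ℛ γ * mono m γ) := by ring
  · rw [norm_zero]; exact mul_nonneg hM0 hc

/-- **The peeling induction**: `E J ρ ≤ ∑_{i∈J} m_i ρ_i` for `ρ ≥ 0`. [this work] -/
theorem E_le (hℛ : ∀ S ∈ ℛ, ∀ S' ∈ ℛ, S ∪ S' ∈ ℛ) (hm : ∀ i, 0 ≤ m i) (hm1 : ∑ i, m i < 1) :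
    ∀ (J : Finset ι) (ρ : ι → ℝ), (∀ i, 0 ≤ ρ i) → E ℛ m J ρ ≤ ∑ i ∈ J, m i * ρ i := by
  intro J
  induction J using Finset.strongInduction with
  | H J ih =>
    intro ρ hρ
    rcases J.eq_empty_or_nonempty with hJ | hJ
    · -- `J = ∅`: only `γ = 0` has support inside `J`, and `c_0 = 0`
      rw [hJ, sum_empty, E]
      have : ∀ γ : ι →₀ ℕ, (if γ.support ⊆ (∅ : Finset ι) then cf ℛ γ * mono m γ * fmin ρ γ.support else 0) = 0 := by
        intro γ
        split_ifs with h
        · have hγ : γ = 0 := Finsupp.support_eq_empty.mp (subset_empty.mp h)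
          rw [hγ, Finsupp.support_zero, fmin, dif_neg (by simp), mul_zero]
        · rfl
      rw [tsum_congr this, tsum_zero]
    · obtain ⟨i₀, hi₀, hmin⟩ := exists_min_image J ρ hJ
      set t := ρ i₀ with ht
      set ρ' : ι → ℝ := fun i => ρ i - t with hρ'
      have ht0 : 0 ≤ t := hρ i₀
      have hρ'J : ∀ i ∈ J, 0 ≤ ρ' i := fun i hi => by simp only [hρ']; linarith [hmin i hi]
      -- the clipped nonnegative version of `ρ'` for the induction hypothesis
      set ρ'' : ι → ℝ := fun i => max (ρ' i) 0 with hρ''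
      have hρ''0 : ∀ i, 0 ≤ ρ'' i := fun i => le_max_right _ _
      have hρ''J : ∀ i ∈ J, ρ'' i = ρ' i := fun i hi => max_eq_left (hρ'J i hi)
      -- pointwise decomposition of the summand on `supp γ ⊆ J`
      have hpt : ∀ γ : ι →₀ ℕ, (if γ.support ⊆ J then cf ℛ γ * mono m γ * fmin ρ γ.support else 0) =
          t * (if γ.support ⊆ J then cf ℛ γ * mono m γ else 0) -
          t * (if γ = 0 then cf ℛ γ * mono m γ else 0) +
          (if γ.support ⊆ J.erase i₀ then cf ℛ γ * mono m γ * fmin ρ'' γ.support else 0) := by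
        intro γ
        by_cases hγ0 : γ = 0
        · rw [hγ0]
          simp only [Finsupp.support_zero, empty_subset, if_true]
          rw [fmin, dif_neg (by simp), fmin, dif_neg (by simp)]
          ring
        · have hne : γ.support.Nonempty := Finsupp.support_nonempty_iff.mpr hγ0
          rw [if_neg hγ0, mul_zero, sub_zero]
          by_cases hJ' : γ.support ⊆ J
          · rw [if_pos hJ', if_pos hJ']
            have hdec : fmin ρ γ.support = t + fmin ρ'' γ.support := by
              have h1 : fmin ρ'' γ.support = fmin ρ' γ.support := by
                rw [fmin, dif_pos hne, fmin, dif_pos hne]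
                exact inf'_congr hne rfl fun i hi => hρ''J i (hJ' hi)
              rw [h1, hρ', fmin_sub_const ρ t hne]; ring
            by_cases hi₀γ : i₀ ∈ γ.support
            · have hz : fmin ρ'' γ.support = 0 :=
                fmin_eq_zero ρ'' (fun i _ => hρ''0 i) hi₀γ (by rw [hρ''J i₀ hi₀]; show ρ i₀ - t = 0; rw [ht, sub_self])
              rw [if_neg (fun h => (mem_erase.mp (h hi₀γ)).1 rfl), hdec, hz]; ring
            · have hsub : γ.support ⊆ J.erase i₀ := fun i hi =>
                mem_erase.mpr ⟨fun h => hi₀γ (by rw [← h]; exact hi), hJ' hi⟩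
              rw [if_pos hsub, hdec]; ring
          · rw [if_neg hJ', if_neg hJ', if_neg (fun h => hJ' (h.trans (erase_subset i₀ J)))]; ring
      have hS1 : Summable fun γ : ι →₀ ℕ => if γ.support ⊆ J then cf ℛ γ * mono m γ else 0 := by
        refine Summable.of_nonneg_of_le (fun γ => ?_) (fun γ => ?_) (summable_cf_mono (ℛ := ℛ) hm hm1)
        · split_ifs
          · exact mul_nonneg (cf_nonneg hℛ γ) (mono_nonneg hm γ)
          · exact le_rfl
        · split_ifs
          · exact le_rfl
          · exact mul_nonneg (cf_nonneg hℛ γ) (mono_nonneg hm γ)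
      have hS2 : Summable fun γ : ι →₀ ℕ => if γ = 0 then cf ℛ γ * mono m γ else 0 :=
        summable_of_ne_finset_zero (s := {0}) fun γ hγ => by rw [if_neg (by simpa using hγ)]
      have hS3 := summable_E_family hℛ hm hm1 (J.erase i₀) ρ'' (∑ j, |ρ'' j|) (sum_nonneg fun j _ => abs_nonneg _)
        fun i => single_le_sum (fun j _ => abs_nonneg (ρ'' j)) (mem_univ i)
      have hE : E ℛ m J ρ = t * ∑' γ : ι →₀ ℕ, (if γ.support ⊆ J then cf ℛ γ * mono m γ else 0)
          - t * ∑' γ : ι →₀ ℕ, (if γ = 0 then cf ℛ γ * mono m γ else 0) + E ℛ m (J.erase i₀) ρ'' := by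
        rw [E, E, tsum_congr hpt, ((hS1.mul_left t).sub (hS2.mul_left t)).tsum_add hS3,
          (hS1.mul_left t).tsum_sub (hS2.mul_left t), tsum_mul_left, tsum_mul_left]
      have h0 : ∑' γ : ι →₀ ℕ, (if γ = 0 then cf ℛ γ * mono m γ else 0) = 0 := by
        rw [tsum_eq_single 0 (fun γ hγ => if_neg hγ), if_pos rfl]
        have hc : cf ℛ 0 = 0 := by
          unfold cf Pser
          rw [coeff_zero_eq_constantCoeff_apply, map_sub, map_one, map_prod]
          have : ∀ S ∈ ℛ, constantCoeff (tS S : MvPowerSeries ι ℚ) = 1 := fun S _ => by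
            unfold tS
            rw [map_mul, constantCoeff_inv, map_prod, map_prod]
            simp [map_sub, map_sum, constantCoeff_X]
          rw [prod_congr rfl this, prod_const_one]; simp
        rw [hc, zero_mul]
      have hlevel := tsum_cf_mono_indicator_le (ℛ := ℛ) hm hm1 J
      have hIH := ih (J.erase i₀) (erase_ssubset hi₀) ρ'' hρ''0
      rw [hE, h0, mul_zero, sub_zero]
      calc t * ∑' γ : ι →₀ ℕ, (if γ.support ⊆ J then cf ℛ γ * mono m γ else 0) + E ℛ m (J.erase i₀) ρ''
          ≤ t * ∑ i ∈ J, m i + ∑ i ∈ J.erase i₀, m i * ρ'' i := by gcongr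
        _ = ∑ i ∈ J, m i * ρ i := by
          have e1 : ∑ i ∈ J.erase i₀, m i * ρ'' i = ∑ i ∈ J.erase i₀, (m i * ρ i - t * m i) :=
            sum_congr rfl fun i hi => by rw [hρ''J i (mem_of_mem_erase hi)]; show m i * (ρ i - t) = _; ring
          have e2 : ∑ i ∈ J, m i = m i₀ + ∑ i ∈ J.erase i₀, m i := (add_sum_erase J m hi₀).symm
          have e3 : ∑ i ∈ J, m i * ρ i = m i₀ * ρ i₀ + ∑ i ∈ J.erase i₀, m i * ρ i :=
            (add_sum_erase J (fun i => m i * ρ i) hi₀).symm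
          rw [e1, sum_sub_distrib, ← mul_sum, e2, e3, ← ht]
          ring

omit [DecidableEq ι] in
/-- `mono (a·b) γ = mono a γ · mono b γ`. [this work] -/
theorem mono_mul_pointwise (a b : ι → ℝ) (γ : ι →₀ ℕ) : mono (fun i => a i * b i) γ = mono a γ * mono b γ := by
  unfold mono; rw [← prod_mul_distrib]; exact prod_congr rfl fun i _ => mul_pow _ _ _

/-- `mono β γ ≤ ∏_{j ∈ supp γ} β j` for `β ∈ [0,1]`. [this work] -/
theorem mono_le_prod_support (β : ι → ℝ) (hβ0 : ∀ i, 0 ≤ β i) (hβ1 : ∀ i, β i ≤ 1) (γ : ι →₀ ℕ) :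
    mono β γ ≤ ∏ j ∈ γ.support, β j := by
  unfold mono
  rw [← prod_filter_mul_prod_filter_not univ (fun i => i ∈ γ.support)]
  have h1 : ∏ i ∈ univ.filter (fun i => ¬ i ∈ γ.support), β i ^ γ i = 1 :=
    prod_eq_one fun i hi => by rw [Finsupp.notMem_support_iff.mp (mem_filter.mp hi).2, pow_zero]
  have h2 : univ.filter (fun i => i ∈ γ.support) = γ.support := by ext i; simp
  rw [h1, mul_one, h2]
  exact prod_le_prod (fun i _ => pow_nonneg (hβ0 i) _) fun i hi =>
    pow_le_of_le_one (hβ0 i) (hβ1 i) (Finsupp.mem_support_iff.mp hi)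

/-- **THEOREM 4 ((MC-atomic), maxitive certificate inequality).**  For masses `m ≥ 0` with `∑ m < 1`, marks `β ∈ [0,1]^ι`,
a UNION-CLOSED family `ℛ` and any `ρ ≥ 0` dominating the `β`-products of the members through each of their elements:
    `1 - ∑_i m_i ρ_i ≤ FR (m·β) ℛ = ∏_{S∈ℛ} t_S[m·β]`. [this work] -/
theorem one_sub_le_FR_atomic (hℛ : ∀ S ∈ ℛ, ∀ S' ∈ ℛ, S ∪ S' ∈ ℛ) (hm : ∀ i, 0 ≤ m i) (hm1 : ∑ i, m i < 1)
    (β : ι → ℝ) (hβ0 : ∀ i, 0 ≤ β i) (hβ1 : ∀ i, β i ≤ 1) (ρ : ι → ℝ) (hρ0 : ∀ i, 0 ≤ ρ i)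
    (hρ : ∀ S ∈ ℛ, ∀ i ∈ S, ∏ j ∈ S, β j ≤ ρ i) :
    1 - ∑ i, m i * ρ i ≤ FR (fun i => m i * β i) ℛ := by
  set φ : ι → ℝ := fun i => m i * β i with hφ
  have hφ0 : ∀ i, 0 ≤ φ i := fun i => mul_nonneg (hm i) (hβ0 i)
  have hφ1 : ∑ i, φ i < 1 :=
    lt_of_le_of_lt (sum_le_sum fun i _ => mul_le_of_le_one_right (hm i) (hβ1 i)) hm1
  have hF := ev_prod_tS hφ0 hφ1 ℛ
  have hA : AbsConv φ (Pser ℛ) := absConv_one.sub hφ0 hF.1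
  have hev : 1 - FR φ ℛ = ∑' γ : ι →₀ ℕ, cf ℛ γ * mono φ γ := by
    have : ev φ (Pser ℛ) = 1 - FR φ ℛ := by rw [Pser, ev_sub hφ0 absConv_one hF.1, ev_one, hF.2]
    rw [← this]; rfl
  -- termwise bound
  have hpt : ∀ γ : ι →₀ ℕ, cf ℛ γ * mono φ γ ≤
      (if γ.support ⊆ (univ : Finset ι) then cf ℛ γ * mono m γ * fmin ρ γ.support else 0) := by
    intro γ
    rw [if_pos (subset_univ _)]
    by_cases hc : cf ℛ γ = 0
    · rw [hc]; simp
    · have hsupp : γ.support ∈ ℛ := by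
        refine support_mem_of_coeff_ne_zero ℛ hℛ γ ?_
        unfold cf Pser at hc; exact_mod_cast hc
      have hne : γ.support.Nonempty := by
        rw [nonempty_iff_ne_empty, Ne, Finsupp.support_eq_empty]
        rintro rfl
        apply hc
        -- `c_0 = 0`
        unfold cf Pser
        rw [coeff_zero_eq_constantCoeff_apply, map_sub, map_one, map_prod]
        have : ∀ S ∈ ℛ, constantCoeff (tS S : MvPowerSeries ι ℚ) = 1 := fun S _ => by
          unfold tS
          rw [map_mul, constantCoeff_inv, map_prod, map_prod]
          simp [map_sub, map_sum, constantCoeff_X]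
        rw [prod_congr rfl this, prod_const_one]; simp
      rw [hφ, mono_mul_pointwise, mul_assoc]
      refine mul_le_mul_of_nonneg_left (mul_le_mul_of_nonneg_left ?_ (mono_nonneg hm γ)) (cf_nonneg hℛ γ)
      rw [fmin, dif_pos hne]
      exact (le_inf'_iff hne ρ).mpr fun i hi => (mono_le_prod_support β hβ0 hβ1 γ).trans (hρ _ hsupp i hi)
  have hS := summable_E_family hℛ hm hm1 univ ρ (∑ j, |ρ j|) (sum_nonneg fun j _ => abs_nonneg _)
    fun i => single_le_sum (fun j _ => abs_nonneg (ρ j)) (mem_univ i)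
  have h1 : 1 - FR φ ℛ ≤ E ℛ m univ ρ := by
    rw [hev, E]
    exact (hA.summable hφ0).tsum_le_tsum hpt hS
  have h2 := E_le hℛ hm hm1 univ ρ hρ0
  linarith

end Grain

end Summit.CriticalPhenomena.PercolationContinuityZ3.Theorems.SunflowerPartition
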